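import Mathlib
import Summits.AnomalousDissipation.AnomalousDissipation.Theorems.SoloBlindLandingFarField

/-!
# SoloBlindLandingLogDatum — where the landing logarithm comes from, and what it is in outer units

Solo-blind programme on `AnomalousDissipation`, paper §24.68(2), CLAIMS SB-C693.  Continuing
`SoloBlindLandingFarField` (`Q(ξ) = ξ⁴/24 + 2(ξ log|ξ| − ξ) + c₀`, `Q′`, `Q″` certified there), we certify

* `hasDerivAt_landQ''`, `hasDerivAt_landQ'''` : `Q‴ = ξ − 2/ξ²`, `Q⁗ = 1 + 4/ξ³` off the origin;
* `landing_log_origin` : with the leading far-field amplitude `α₀(ξ) = ξ²/√24` (so `α₀² = ξ⁴/24`,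
  `α₀″ = 2/√24`) one has the exact identity `Q‴ + α₀″/α₀ = ξ` for `ξ ≠ 0` — the logarithm
  `2(ξ log|ξ| − ξ)` is precisely the term that balances the 'quantum-pressure' ratio `α″/α = 2/ξ²`
  against the linear strain in the leading inner law (transport `Q‴` + pressure `α″/α` = strain `ξ`);
  equivalently `landQ''''_sub_one` : `Q⁗ − 1 = 4/ξ³`, the defect of the quartic law;
* `outer_log_split`, `outer_slope_datum` : in outer variables `x − xₑ = L ξ` (`L > 0`) the slope term
  `(q_s/L)·2 log(|x − xₑ|/L)` equals `(2q_s/L) log|x − xₑ| + (2q_s/L) log(1/L)` — the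
  `O(L³ log(1/L))`-type landing slope datum of §24.68(2) (with `q_s ∝ L⁴`).

Elementary calculus and algebra only; nothing about the inner problem itself is claimed.
-/

namespace Summit.AnomalousDissipation.AnomalousDissipation.Theorems

/-- Third derivative of the landing far field off the origin, `Q‴(ξ) = ξ − 2/ξ²`. -/
noncomputable def landQ''' (ξ : ℝ) : ℝ := ξ - 2 / ξ ^ 2

/-- Fourth derivative of the landing far field off the origin, `Q⁗(ξ) = 1 + 4/ξ³`. -/
noncomputable def landQ'''' (ξ : ℝ) : ℝ := 1 + 4 / ξ ^ 3

/-- Leading far-field amplitude of the landing member, `α₀(ξ) = ξ²/√24` (so that `α₀² = ξ⁴/24`). -/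
noncomputable def landAlpha0 (ξ : ℝ) : ℝ := ξ ^ 2 / Real.sqrt 24

/-- Its first derivative, `α₀′(ξ) = 2ξ/√24`. -/
noncomputable def landAlpha0' (ξ : ℝ) : ℝ := 2 * ξ / Real.sqrt 24

/-- Its (constant) second derivative, `α₀″ = 2/√24`. -/
noncomputable def landAlpha0'' : ℝ := 2 / Real.sqrt 24

/-- `Q″ = ξ²/2 + 2/ξ` has derivative `Q‴ = ξ − 2/ξ²` at every `ξ ≠ 0`. -/
theorem hasDerivAt_landQ'' {ξ : ℝ} (hξ : ξ ≠ 0) : HasDerivAt landQ'' (landQ''' ξ) ξ := by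
  have h1 : HasDerivAt (fun x : ℝ => x ^ 2 / 2) (↑2 * ξ ^ (2 - 1) / 2) ξ :=
    (hasDerivAt_pow 2 ξ).div_const 2
  have h2 : HasDerivAt (fun x : ℝ => 2 * x⁻¹) (2 * (-(ξ ^ 2)⁻¹)) ξ :=
    (hasDerivAt_inv hξ).const_mul 2
  have h : HasDerivAt (fun x : ℝ => x ^ 2 / 2 + 2 * x⁻¹)
      (↑2 * ξ ^ (2 - 1) / 2 + 2 * (-(ξ ^ 2)⁻¹)) ξ := h1.add h2
  have e : landQ'' = fun x : ℝ => x ^ 2 / 2 + 2 * x⁻¹ := by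
    funext x
    simp [landQ'', div_eq_mul_inv]
  rw [e]
  refine h.congr_deriv ?_
  simp only [landQ''']
  field_simp
  ring

/-- `Q‴ = ξ − 2/ξ²` has derivative `Q⁗ = 1 + 4/ξ³` at every `ξ ≠ 0`. -/
theorem hasDerivAt_landQ''' {ξ : ℝ} (hξ : ξ ≠ 0) : HasDerivAt landQ''' (landQ'''' ξ) ξ := by
  have h1 : HasDerivAt (fun x : ℝ => x) 1 ξ := hasDerivAt_id ξ
  have hp : HasDerivAt (fun x : ℝ => x ^ 2) (↑2 * ξ ^ (2 - 1)) ξ := hasDerivAt_pow 2 ξ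
  have hξ2 : ξ ^ 2 ≠ 0 := pow_ne_zero 2 hξ
  have h2 : HasDerivAt (fun x : ℝ => 2 * (x ^ 2)⁻¹) (2 * (-(↑2 * ξ ^ (2 - 1)) / (ξ ^ 2) ^ 2)) ξ :=
    (hp.inv hξ2).const_mul 2
  have h : HasDerivAt (fun x : ℝ => x - 2 * (x ^ 2)⁻¹)
      (1 - 2 * (-(↑2 * ξ ^ (2 - 1)) / (ξ ^ 2) ^ 2)) ξ := h1.sub h2
  have e : landQ''' = fun x : ℝ => x - 2 * (x ^ 2)⁻¹ := by
    funext x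
    simp [landQ''', div_eq_mul_inv]
  rw [e]
  refine h.congr_deriv ?_
  simp only [landQ'''']
  field_simp
  ring

/-- The defect of the quartic law: `Q⁗ − 1 = 4/ξ³`. -/
theorem landQ''''_sub_one (ξ : ℝ) : landQ'''' ξ - 1 = 4 / ξ ^ 3 := by
  simp [landQ'''']

/-- `α₀² = ξ⁴/24`: the leading amplitude squares to the quartic part of `Q`. -/
theorem landAlpha0_sq (ξ : ℝ) : landAlpha0 ξ ^ 2 = ξ ^ 4 / 24 := by
  have h24 : Real.sqrt 24 ^ 2 = 24 := Real.sq_sqrt (by norm_num)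
  unfold landAlpha0
  rw [div_pow, h24]
  ring

/-- `α₀ = ξ²/√24` has derivative `α₀′ = 2ξ/√24`. -/
theorem hasDerivAt_landAlpha0 (ξ : ℝ) : HasDerivAt landAlpha0 (landAlpha0' ξ) ξ := by
  have h : HasDerivAt (fun x : ℝ => x ^ 2 / Real.sqrt 24) (↑2 * ξ ^ (2 - 1) / Real.sqrt 24) ξ :=
    (hasDerivAt_pow 2 ξ).div_const (Real.sqrt 24)
  have e : landAlpha0 = fun x : ℝ => x ^ 2 / Real.sqrt 24 := by
    funext x
    simp [landAlpha0]
  rw [e]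
  refine h.congr_deriv ?_
  simp [landAlpha0']

/-- `α₀′ = 2ξ/√24` has derivative `α₀″ = 2/√24`. -/
theorem hasDerivAt_landAlpha0' (ξ : ℝ) : HasDerivAt landAlpha0' landAlpha0'' ξ := by
  have h : HasDerivAt (fun x : ℝ => 2 * x / Real.sqrt 24) (2 * 1 / Real.sqrt 24) ξ :=
    ((hasDerivAt_id ξ).const_mul 2).div_const (Real.sqrt 24)
  have e : landAlpha0' = fun x : ℝ => 2 * x / Real.sqrt 24 := by
    funext x
    simp [landAlpha0']
  rw [e]
  refine h.congr_deriv ?_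
  simp [landAlpha0'']

/-- The 'quantum-pressure' ratio of the leading amplitude: `α₀″/α₀ = 2/ξ²`. -/
theorem landAlpha0''_div (ξ : ℝ) : landAlpha0'' / landAlpha0 ξ = 2 / ξ ^ 2 := by
  have hs : Real.sqrt 24 ≠ 0 := by positivity
  simp only [landAlpha0'', landAlpha0]
  rw [div_div_eq_mul_div, div_mul_cancel₀ _ hs]

/-- ORIGIN OF THE LOGARITHM: `Q‴ + α₀″/α₀ = ξ` exactly, for `ξ ≠ 0` — the term `2(ξ log|ξ| − ξ)` of `Q`
is what balances the pressure ratio `2/ξ²` against the linear strain in the leading inner law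
(meaningful for `ξ ≠ 0`; with Lean's `x/0 = 0` convention the identity happens to hold at `ξ = 0` too). -/
theorem landing_log_origin (ξ : ℝ) :
    landQ''' ξ + landAlpha0'' / landAlpha0 ξ = ξ := by
  rw [landAlpha0''_div ξ]
  unfold landQ'''
  ring

/-- Outer/inner splitting of the logarithm: with `x − xₑ = L ξ`, `L > 0`, `x ≠ xₑ`,
`log(|x − xₑ|/L) = log|x − xₑ| − log L`. -/
theorem outer_log_split (x xe L : ℝ) (hL : 0 < L) (hx : x ≠ xe) :
    Real.log (|x - xe| / L) = Real.log |x - xe| - Real.log L := by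
  have h1 : |x - xe| ≠ 0 := abs_ne_zero.mpr (sub_ne_zero.mpr hx)
  have h2 : L ≠ 0 := ne_of_gt hL
  rw [Real.log_div h1 h2]

/-- THE LANDING SLOPE DATUM IN OUTER UNITS: the inner slope term `(q_s/L)·(2 log(|x − xₑ|/L))` equals
`(2 q_s/L) log|x − xₑ| + (2 q_s/L) log(1/L)`; with `q_s ∝ L⁴` the second piece is the
`O(L³ log(1/L))` datum of §24.68(2). -/
theorem outer_slope_datum (qs x xe L : ℝ) (hL : 0 < L) (hx : x ≠ xe) :
    qs / L * (2 * Real.log (|x - xe| / L))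
      = 2 * qs / L * Real.log |x - xe| + 2 * qs / L * Real.log (1 / L) := by
  rw [outer_log_split x xe L hL hx, one_div, Real.log_inv]
  ring

end Summit.AnomalousDissipation.AnomalousDissipation.Theorems
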